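import Literature.MathematicalPhysics.QuantumFieldTheory.Balaban1983to89.B5Eq112TorusCarriers
import Literature.MathematicalPhysics.QuantumFieldTheory.Balaban1983to89.B5Eq147Landau
import Literature.MathematicalPhysics.QuantumFieldTheory.Balaban1983to89.B5Eq117FibreVolume

/-!
# `Balaban1983to89.B5Eq112TorusBridge` — T. Bałaban, *Propagators and renormalization transformations for lattice gauge
theories. I*, Commun. Math. Phys. **95** (1984) 17–40 [Balaban1984PropagatorsI], (1.12) p. 19: the renormalization transformation
`(Te^{−S})(B) = ∫dA δ(B − QA)δ_Ax(A)e^{−S(A)}` — the KNITTING of its two formalizations in the tree: the declaration of record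
`B5Eq112RenormTransf.renormTransf` (V1 lattice calculus) IS, up to one positive constant, the torus-carrier twin
`B5SectBStatements.rtT`/`rt12`, for every gauge-invariant density (file 2 of 2; carriers and slices = `B5Eq112TorusCarriers`)

statement-level skeleton of published theorems with citation tags; proofs where landed; nothing here is a claim about the Yang–Mills mass gap

PDF held: `paper:balaban1984-cmp95-propagators-rt-i` (journal page = PDF page + 16); pp. 19–21, 25–26 [PDF 3–5, 9–10] read from the
materialised text `~/.lit/texts/paper-balaban1984-cmp95-propagators-rt-i/p0003.txt … p0010.txt` (and the ×2 page renders under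
`run/shared/lean/pub/pub-balaban/b2b-balaban-ref1/pages/1984-cmp95-propagators-rt-I/`).

PRINT, verbatim.  p. 19 [PDF 3]: *"then the renormalization transformation T is defined by (Te^{−S})(B) = ∫dA δ(B − QA)δ_Ax(A)e^{−S(A)}.
(1.12) … Fixing it we restrict the gauge transformations by the condition (Q′λ)(y) = 0. The remaining gauge degrees of freedom are
removed by the term δ_Ax(A). In the future we will use both points of view."*  p. 21 [PDF 5]: *"The restrictions on the gauge
transformations given by the δ-functions above are chosen in such a way that all the expressions in the integral (1.17) with the
exception of gauge fixing terms δ_Ax are invariant."*  p. 25 [PDF 9], (1.40): *"∫dλ δ(Q′_kλ) exp(−(1/2α)‖Δλ‖²) = ∫_{N(Q′_k)} dλ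
exp(−(1/2α)‖Δλ‖²)"* (the paper's reading of a δ-function of linear constraints as the flat measure of the constraint subspace).
p. 26 [PDF 10]: *"We may introduce this gauge from the beginning using the equation ∫dλ δ(Q′_kλ)∣det(Δ↾_{N(Q′_k)})∣δ_R(∂*A − Δλ) = 1.
(1.46)"* — a gauge-invariant δ-integral does not depend on WHICH complete gauge fixing of the residual group `{λ : Q′λ = 0}` is
inserted, up to its normalisation.

CITATION HEADER (lean-in-tree rule) — WHAT IS REPRODUCED.  SKELETON row `B5.Eq1.12` ([DEF]; fold owner r02; decl of record = seat p16's
`B5Eq112RenormTransf.renormTransf`, lead ruling G.5-34(c)), the KNITTING item left open in `B5SectBStatements` ("TWIN CARRIER BY DESIGN …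
a bridge between the two carriers is a later knitting item") and in HOME/HANDOFF.md (p16 gen 2), FILE 2 of 2.  The two formalizations
of (1.12): V1 — `B5Eq112RenormTransf.renormTransf S B = B9Eq3166.subInt (kerBasisMatrix P j) (A′ ↦ e^{−S(faceField B + A′)})`, the
Lebesgue integral over the fibre `{A axial (CENTRED trees), QA = B}` written in a basis of `axialKer`; torus twin —
`B5SectBStatements.rtT ρ = deltaInt Qlin Ax ρ` (convention (1.40): flat measure of the constraint subspace `{QA′ = 0} ∩ Ax`, CORNER
trees), `rt12 = rtT e^{−S}` with the unit-lattice action (1.5) `B5Action121.actionS _ 1 1`.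
WHAT IS PROVED (kernel, no `sorry`, standard axioms; standing range `j + 1 ≤ m + K` of `Setup.Params`):
* §3 `renormTransf_eq_deltaInt`: the V1 integral IS the torus-side δ-integral of the transported density `A′ ↦ e^{−S(trV⁻¹A′)}` over
  the fibre `{QA′ = trB B} ∩ axT` (`axT` = the transported CENTRED axial subspace of `B5Eq112TorusCarriers`): ambient reindexing of
  `subInt` (`subInt_reindex`) + p38's `B5Eq117FibreVolume.subInt_eq_integral_submodule` (`√det(Gram)`·Lebesgue = subspace volume);
* §4 **THE BRIDGE** `renormTransf_eq_const_mul_rtT`: ONE `c > 0` (a function of `P`, `j` only) with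
  `renormTransf S B = c · rtT L Mc (A′ ↦ e^{−S(trV⁻¹A′)}) (trB B)` for EVERY density `S` invariant under the gauge transformations
  (1.4) and every `B` — the (1.46)-type exchange of gauge slices `B5Eq147Landau.deltaInt_exchange` between the two axial gauges
  (`B5Eq112TorusCarriers.isCompl_axT_Otor` / `isCompl_Ax_Otor`, `Otor_le_ker`); whence `renormTransf_curlAction_eq_const_mul_rtT`
  (abelian actions (1.3), any weight and lattice factor) and **`renormTransf_eq_const_mul_rt12`:
  `B5Eq112RenormTransf.renormTransf (curlAction 1 1) B = c · B5SectBStatements.rt12 L Mc (trB B)`** — the declaration of record and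
  its twin are one object.
HONEST SCOPE.  (i) The two files fix DIFFERENT axial trees inside each block (centre-anchored vs corner-anchored staircases), so for
a density that is NOT gauge invariant the two (1.12)-integrals are genuinely different numbers and no identity is claimed; the bridge
is exactly the printed gauge-independence («all the expressions … with the exception of gauge fixing terms δ_Ax are invariant»).
(ii) The constant `c` is the Jacobian of the slice-to-slice map in the flat normalisations of the two δ-measures (convention (1.40) on
both sides; the paper absorbs such factors in «Z^{(0)}» of (1.14)); it is existential, as in every typed (1.14)/(1.17)/(1.23)/(1.47)
claim of the cell, and is not evaluated.  (iii) U = 1, real (abelian) fields — the paper's own setting of Sect. 1 — every `d ≥ 1`,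
odd `L > 1` (the `Setup` parameters).  Theorems only; no new definitions, no `def … : Prop`.

Unit `lit-balaban-p16` gen 3 (Phase-2 proof seat p16; literature-prover-lit-balaban-p16-g3-0), HOME `run/shared/lean/pub/lit-balaban/`
(STATUS: `lit-balaban-p16/STATUS.md`), 2026-08-21.
-/

open scoped BigOperators Matrix

namespace Literature.MathematicalPhysics.QuantumFieldTheory.Balaban1983to89

namespace B5Eq112TorusBridge

open LatticeFieldCalculus B5SectBStatements B5Eq112TorusCarriers
open B5Prop11Plancherel (Tor fine unitVec)
open B5Eq112RenormTransf
open B9Eq3166 (subInt)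

noncomputable section

variable {P : Params} {j : ℕ}

/-! ## §3  The V1 integral (1.12) read as a δ-integral (convention (1.40)) on the torus carrier -/

section Integral

/-- reindexing the AMBIENT coordinates of a subspace integral `√det(NᵀN)·∫f(Nz)dz` along a bijection `σ` of the index set changes
nothing (same Gram matrix, same parametrisation) — (1.12) may be read in either labelling of the bonds.
[cite: Balaban1984PropagatorsI, (1.12) p.19] -/
theorem subInt_reindex {n m τ : Type*} [Fintype n] [Fintype m] [Fintype τ] [DecidableEq τ] (σ : m ≃ n)
    (N : Matrix n τ ℝ) (f : (n → ℝ) → ℝ) :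
    subInt N f = subInt (N.submatrix σ id) (fun v => f (v ∘ σ.symm)) := by
  have hmv : ∀ z : τ → ℝ, N.submatrix σ id *ᵥ z = (N *ᵥ z) ∘ σ := fun z => rfl
  have hgram : (N.submatrix σ id)ᵀ * N.submatrix σ id = Nᵀ * N := by
    ext a b
    simp only [Matrix.mul_apply, Matrix.transpose_apply, Matrix.submatrix_apply, id]
    exact Equiv.sum_comp σ (fun k => N k a * N k b)
  unfold subInt
  rw [hgram]
  congr 1
  refine MeasureTheory.integral_congr_ae (Filter.Eventually.of_forall fun z => ?_)
  simp only [hmv, Function.comp_assoc, Equiv.self_comp_symm, Function.comp_id]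

/-- **(1.12) of V1 read on the torus carrier**: `B5Eq112RenormTransf.renormTransf S B` IS the δ-integral `deltaInt` (B5's own
convention (1.40): flat measure of the constraint subspace) of the transported density `A′ ↦ e^{−S(trV⁻¹A′)}` over the fibre
`{A′ : QA′ = trB B} ∩ axT` — same normalisation (`√det(Gram)`·Lebesgue = subspace volume, p38's
`B5Eq117FibreVolume.subInt_eq_integral_submodule`), base point the transported face field. [cite: Balaban1984PropagatorsI, (1.12) p.19] -/
theorem renormTransf_eq_deltaInt (hj : j + 1 ≤ P.m + P.K) (S : VecField P j ℝ → ℝ) (B : VecField P (j + 1) ℝ) :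
    renormTransf S B = deltaInt (Qlin P.L (Mc P j)) (axT hj) (fun A' => Real.exp (-S ((trV hj).symm A'))) (trB B) := by
  set σ := (eBond hj).symm with hσ
  set N' : Matrix (Tor (fine P.L (Mc P j)) × Fin P.d) (Fin (kerDim P j)) ℝ := (kerBasisMatrix P j).submatrix σ id
    with hN'
  have hmv : ∀ z, N' *ᵥ z = (kerBasisMatrix P j *ᵥ z) ∘ σ := fun z => rfl
  have hN'inj : Function.Injective N'.mulVec := by
    intro z w h
    apply (isBasisOf_kerBasisMatrix (P := P) (j := j)).inj
    have h' : (kerBasisMatrix P j *ᵥ z) ∘ σ = (kerBasisMatrix P j *ᵥ w) ∘ σ := by rw [← hmv, ← hmv]; exact h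
    funext b
    have := congrFun h' (σ.symm b)
    simpa only [Function.comp_apply, Equiv.apply_symm_apply] using this
  -- the direction space of the torus-side fibre is spanned by the reindexed basis matrix
  have hK : ∀ x : Fld (fine P.L (Mc P j)),
      x ∈ dirSpace (Qlin P.L (Mc P j)) (axT hj) ↔ WithLp.ofLp x ∈ Set.range N'.mulVec := by
    intro x
    have hx : WithLp.ofLp x ∘ ⇑σ.symm = (trV hj).symm x := rfl
    rw [mem_dirSpace_iff, mem_axT_iff, Set.mem_range]
    have e1 : Qlin P.L (Mc P j) x = 0 ↔ bondAvg ((trV hj).symm x) = 0 := by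
      conv_lhs => rw [← (trV hj).apply_symm_apply x, Qlin_trV]
      exact (trB (P := P) (j := j)).map_eq_zero_iff
    rw [e1]
    constructor
    · rintro ⟨hQ, hAx⟩
      have hmem : (trV hj).symm x ∈ (axialKer P j ℝ : Set (VecField P j ℝ)) := ⟨hAx, hQ⟩
      obtain ⟨z, hz⟩ := ((isBasisOf_kerBasisMatrix (P := P) (j := j)).mem_iff _).1 hmem
      refine ⟨z, ?_⟩
      rw [hmv, hz, ← hx, Function.comp_assoc, Equiv.symm_comp_self, Function.comp_id]
    · rintro ⟨z, hz⟩
      have hz' : kerBasisMatrix P j *ᵥ z = (trV hj).symm x := by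
        rw [← hx, ← hz, hmv, Function.comp_assoc, Equiv.self_comp_symm, Function.comp_id]
      have hmem : (trV hj).symm x ∈ (axialKer P j ℝ : Set (VecField P j ℝ)) :=
        ((isBasisOf_kerBasisMatrix (P := P) (j := j)).mem_iff _).2 ⟨z, hz'⟩
      exact ⟨hmem.2, hmem.1⟩
  -- the base point: the transported face field lies on the torus-side fibre
  have hA₀ : trV hj (faceField B) ∈ fibre (Qlin P.L (Mc P j)) (axT hj) (trB B) := by
    refine ⟨by rw [Qlin_trV, bondAvg_faceField hj], (mem_axT_iff hj _).2 ?_⟩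
    rw [LinearEquiv.symm_apply_apply]
    exact isAxial_faceField hj B
  rw [deltaInt_eq _ hA₀, renormTransf, subInt_reindex σ,
    ← B5Eq117FibreVolume.subInt_eq_integral_submodule N' hN'inj _ hK
      (fun x => Real.exp (-S ((trV hj).symm (trV hj (faceField B) + x))))]
  congr 1
  funext v
  simp only [map_add, LinearEquiv.symm_apply_apply]
  rfl

end Integral

/-! ## §4  THE BRIDGE: V1's (1.12) = c · the torus twin, for every gauge-invariant density («We may introduce this gauge from the
beginning using the equation (1.46)»: exchanging one complete gauge fixing of `{λ : Q′λ = 0}` for another costs a constant) -/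

section Bridge

/-- adding a torus-side orbit direction `∂λ` is, after pull-back, the V1 gauge transformation (1.4) `A ↦ A − ∂^{c₀}(−c₀⁻¹λ)`.
[cite: Balaban1984PropagatorsI, (1.4) p.18] -/
theorem trV_symm_add_Dgrad (hj : j + 1 ≤ P.m + P.K) {c₀ : ℝ} (hc₀ : c₀ ≠ 0) (A' : Fld (fine P.L (Mc P j)))
    (l : Scl (fine P.L (Mc P j))) :
    (trV hj).symm (A' + B5HierGaugeTorus.Dgrad _ 1 l)
      = gaugeShift c₀ (-(c₀⁻¹ • (trS hj).symm l)) ((trV hj).symm A') := by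
  rw [map_add, trV_symm_Dgrad]
  funext b
  simp only [Pi.add_apply, gaugeShift, grad, Pi.neg_apply, Pi.smul_apply, smul_eq_mul]
  field_simp
  ring

/-- **THE BRIDGE (row B5.Eq1.12)** p. 19 [PDF 3]: the two formalizations of *"(Te^{−S})(B) = ∫dA δ(B − QA)δ_Ax(A)e^{−S(A)} (1.12)"*
are ONE object — there is ONE constant `c > 0` (a function of `P`, `j`: the Jacobian of the change of axial gauge, cf. (1.46)) such
that for every lattice factor `c₀ ≠ 0`, every density `S` of the fine V1 field invariant under the gauge transformations (1.4)
`A ↦ A − ∂^{c₀}λ`, and every block field `B`: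
`B5Eq112RenormTransf.renormTransf S B = c · B5SectBStatements.rtT L Mc (A′ ↦ e^{−S(trV⁻¹A′)}) (trB B)`.
Proof = §3 + the slice exchange `B5Eq147Landau.deltaInt_exchange` between the transported centred-axial gauge `axT` and the
corner-axial gauge `Ax`, both complements of `{∂λ : Q′λ = 0} ≤ N(Q)` (§2), the density being invariant along that orbit («all the
expressions … with the exception of gauge fixing terms δ_Ax are invariant», p. 21). [cite: Balaban1984PropagatorsI, (1.12) p.19, (1.46) p.26] -/
theorem renormTransf_eq_const_mul_rtT (hj : j + 1 ≤ P.m + P.K) :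
    ∃ c : ℝ, 0 < c ∧ ∀ (c₀ : ℝ), c₀ ≠ 0 → ∀ S : VecField P j ℝ → ℝ,
      (∀ (lam : SiteField P j ℝ) (A : VecField P j ℝ), S (gaugeShift c₀ lam A) = S A) →
      ∀ B : VecField P (j + 1) ℝ,
        renormTransf S B
          = c * rtT P.L (Mc P j) (fun A' => Real.exp (-S ((trV hj).symm A'))) (trB B) := by
  obtain ⟨c, hc, h⟩ := B5Eq147Landau.deltaInt_exchange (Qlin P.L (Mc P j)) (Otor_le_ker P.L (Mc P j))
    (isCompl_axT_Otor hj) (isCompl_Ax_Otor P.L (Mc P j))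
  refine ⟨c, hc, fun c₀ hc₀ S hS B => ?_⟩
  rw [renormTransf_eq_deltaInt hj S B]
  refine h _ (fun A' g hg => ?_) (trB B)
  obtain ⟨l, -, rfl⟩ := (mem_Otor_iff _ _ g).1 hg
  simp only [trV_symm_add_Dgrad hj hc₀, hS]

/-- the bridge for the abelian actions (1.3): `(Te^{−S})` of V1 with `S = curlAction w c₀ = ½Σ_p w|(∂^{c₀}A)(p)|²` equals `c·rtT`
of `e^{−actionS}` with the same lattice factor and weight (dictionary `actionS_trV`; gauge invariance `curlAction_gaugeShift`).
[cite: Balaban1984PropagatorsI, (1.12) p.19] -/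
theorem renormTransf_curlAction_eq_const_mul_rtT (hj : j + 1 ≤ P.m + P.K) :
    ∃ c : ℝ, 0 < c ∧ ∀ (w c₀ : ℝ) (B : VecField P (j + 1) ℝ),
      renormTransf (curlAction w c₀) B
        = c * rtT P.L (Mc P j)
            (fun A' => Real.exp (-B5Action121.actionS (fine P.L (Mc P j)) (c₀ : ℂ) w (cplx A'))) (trB B) := by
  obtain ⟨c, hc, h⟩ := renormTransf_eq_const_mul_rtT (P := P) (j := j) hj
  refine ⟨c, hc, fun w c₀ B => ?_⟩
  rw [h 1 one_ne_zero (curlAction w c₀) (fun lam A => curlAction_gaugeShift w c₀ 1 lam A) B]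
  congr 2
  funext A'
  rw [← actionS_trV hj c₀ w, LinearEquiv.apply_symm_apply]

/-- **(1.12) OF RECORD = c · (1.12) TWIN**, verbatim objects on both sides: for the unit-lattice action (1.5) (`curlAction 1 1` on
V1, `action1 = actionS _ 1 1` inside `rt12`), `B5Eq112RenormTransf.renormTransf (curlAction 1 1) B = c · B5SectBStatements.rt12 L Mc
(trB B)` with ONE `c > 0` for all block fields `B` (standing range `j + 1 ≤ m + K`). [cite: Balaban1984PropagatorsI, (1.12) p.19] -/
theorem renormTransf_eq_const_mul_rt12 (hj : j + 1 ≤ P.m + P.K) :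
    ∃ c : ℝ, 0 < c ∧ ∀ B : VecField P (j + 1) ℝ,
      renormTransf (curlAction 1 1) B = c * rt12 P.L (Mc P j) (trB B) := by
  obtain ⟨c, hc, h⟩ := renormTransf_curlAction_eq_const_mul_rtT (P := P) (j := j) hj
  refine ⟨c, hc, fun B => ?_⟩
  rw [h 1 1 B, rt12]
  congr 2

end Bridge

end

end B5Eq112TorusBridge
end Literature.MathematicalPhysics.QuantumFieldTheory.Balaban1983to89
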